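import Literature.Analysis.FluidPDE.PassiveScalarProofs
import Literature.Analysis.FunctionSpaces.TorusMollifierEstimates
import HarnessLib

/-!
# The renormalised slice identity for mollified passive scalars with rough drifts

Analysis/FluidPDE proof-support file (everything proved). For a time slice `δ = θ(s) ∈ L¹(T^d)`,
a drift `v = u(s)` that is only integrable with `‖v‖ δ ∈ L¹` (no pointwise bound — the
`L² ∩ Ḣ¹` drifts of Seis 2022, Thm. 2), the standard kernel `k`, the mollified slice
`A = δ ⋆ k` and a smooth function `β : ℝ → ℝ`, we prove the pointwise-in-time part of the
DiPerna–Lions renormalised energy computation (DiPerna–Lions 1989, §II.3, the equation for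
`β(u_ε)`):

* `Torus.IsSmooth.comp_left`, `Torus.gradient_comp_left`, `Torus.partialDeriv_comp_left` — chain
  rules `∇(β ∘ A) = β'(A) ∇A` on the torus;
* `Torus.integral_deriv_comp_mul_inner_gradient_eq_zero` — `∫ β'(A) ⟪v, ∇A⟫ = 0` for an
  integrable weakly divergence-free `v` (test the weak incompressibility with `β ∘ A`);
* `Torus.integral_deriv_comp_mul_laplacian` — `∫ β'(A) ΔA = -∫ β''(A) ‖∇A‖²` (Green on `T^d`);
* `Torus.fluxIntegral_eq_comm_sub_add_of_integrable` — the flux algebra `G = r - ⟪v, ∇A⟫ + κΔA`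
  for integrable (not continuous) drifts;
* `Torus.integral_deriv_comp_mul_flux_eq` — **the renormalised slice identity**
  `∫ β'(A) G = ∫ β'(A) r - κ ∫ β''(A) ‖∇A‖²`, with the DiPerna–Lions commutator `r`.

## References

* R. J. DiPerna, P.-L. Lions, Invent. Math. 98 (1989), §II.1, §II.3. [`DiPernaLions1989`]
* L. C. Evans, *Partial Differential Equations* (2010), App. C.2 Thm. 3 (Green's identities).
-/

noncomputable section

open MeasureTheory TopologicalSpace Set Function Filter Topology Metric ContinuousLinearMap
open scoped ENNReal NNReal Convolution ContDiff InnerProductSpace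

namespace Literature.Analysis.FluidPDE

namespace Torus

variable {d : Type*} [Fintype d]

/-! ## Chain rules for `β ∘ A` on the torus -/

section ChainRule

variable {β : ℝ → ℝ} {A : UnitAddTorus d → ℝ}

/-- A smooth function of a smooth scalar field is smooth. [folklore] -/
theorem _root_.Literature.Analysis.FunctionSpaces.Torus.IsSmooth.comp_left (hβ : ContDiff ℝ ∞ β)
    (hA : FunctionSpaces.Torus.IsSmooth A) : FunctionSpaces.Torus.IsSmooth (β ∘ A) :=
  hβ.comp hA

/-- **Chain rule for the torus derivative**: `D(β ∘ A)(x) w = β'(A x) · DA(x) w` for `C¹` data. [folklore] -/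
theorem fderiv_comp_left_apply (hβ : ContDiff ℝ 1 β) (hA : FunctionSpaces.Torus.IsContDiff 1 A)
    (x : UnitAddTorus d) (w : EuclideanSpace ℝ d) :
    FunctionSpaces.Torus.fderiv (β ∘ A) x w = deriv β (A x) * FunctionSpaces.Torus.fderiv A x w := by
  have hlift : FunctionSpaces.Torus.liftAt (β ∘ A) x = β ∘ FunctionSpaces.Torus.liftAt A x := rfl
  have hA' : HasFDerivAt (FunctionSpaces.Torus.liftAt A x)
      (_root_.fderiv ℝ (FunctionSpaces.Torus.liftAt A x) 0) 0 :=
    ((hA.liftAt x).differentiable one_ne_zero 0).hasFDerivAt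
  have hβ' : HasDerivAt β (deriv β (FunctionSpaces.Torus.liftAt A x 0)) (FunctionSpaces.Torus.liftAt A x 0) :=
    (hβ.differentiable one_ne_zero _).hasDerivAt
  have hc := (hβ'.hasFDerivAt.comp 0 hA').fderiv
  rw [FunctionSpaces.Torus.fderiv, FunctionSpaces.Torus.fderiv, hlift, hc, ContinuousLinearMap.comp_apply,
    ContinuousLinearMap.toSpanSingleton_apply, smul_eq_mul, FunctionSpaces.Torus.liftAt_apply_zero, mul_comm]

/-- **Chain rule for the torus gradient**: `∇(β ∘ A)(x) = β'(A x) • ∇A(x)` for `C¹` data. [folklore] -/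
theorem gradient_comp_left (hβ : ContDiff ℝ 1 β) (hA : FunctionSpaces.Torus.IsContDiff 1 A)
    (x : UnitAddTorus d) :
    FunctionSpaces.Torus.gradient (β ∘ A) x = deriv β (A x) • FunctionSpaces.Torus.gradient A x := by
  refine ext_inner_right ℝ fun w => ?_
  rw [FunctionSpaces.Torus.inner_gradient_left, real_inner_smul_left, FunctionSpaces.Torus.inner_gradient_left,
    fderiv_comp_left_apply hβ hA x w]

/-- **Chain rule for torus partial derivatives**: `∂ⱼ(β ∘ A)(x) = β'(A x) ∂ⱼA(x)`. [folklore] -/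
theorem partialDeriv_comp_left [DecidableEq d] (hβ : ContDiff ℝ 1 β) (hA : FunctionSpaces.Torus.IsContDiff 1 A)
    (j : d) (x : UnitAddTorus d) :
    FunctionSpaces.Torus.partialDeriv j (β ∘ A) x = deriv β (A x) * FunctionSpaces.Torus.partialDeriv j A x := by
  have h1 : FunctionSpaces.Torus.IsContDiff 1 (β ∘ A) := hβ.comp hA
  rw [FunctionSpaces.Torus.partialDeriv_eq_fderiv_apply h1, FunctionSpaces.Torus.partialDeriv_eq_fderiv_apply hA]
  exact fderiv_comp_left_apply hβ hA x _

end ChainRule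

/-! ## The two integrals of the renormalised slice computation -/

section SliceIntegrals

variable {β : ℝ → ℝ} {A : UnitAddTorus d → ℝ} {v : UnitAddTorus d → EuclideanSpace ℝ d}

/-- **Weak incompressibility kills the transport term**: `∫ β'(A) ⟪v, ∇A⟫ = 0` for a weakly
divergence-free `v`, smooth `A` and smooth `β` (`β'(A) ∇A = ∇(β ∘ A)` and `β ∘ A` is an
admissible test function). [folklore] -/
theorem integral_deriv_comp_mul_inner_gradient_eq_zero (hβ : ContDiff ℝ ∞ β)
    (hA : FunctionSpaces.Torus.IsSmooth A) (hdiv : FunctionSpaces.Torus.IsWeaklyDivFree v) :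
    ∫ x, deriv β (A x) * ⟪v x, FunctionSpaces.Torus.gradient A x⟫_ℝ = 0 := by
  have hA1 : FunctionSpaces.Torus.IsContDiff 1 A := hA.isContDiff (by simp)
  have hβ1 : ContDiff ℝ 1 β := hβ.of_le (by simp)
  have e : (fun x => deriv β (A x) * ⟪v x, FunctionSpaces.Torus.gradient A x⟫_ℝ) =
      fun x => ⟪v x, FunctionSpaces.Torus.gradient (β ∘ A) x⟫_ℝ := by
    funext x
    rw [gradient_comp_left hβ1 hA1, real_inner_smul_right]
  rw [e]
  exact hdiv _ (hA.comp_left hβ)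

/-- **Green's identity for the renormalised diffusion term**: `∫ β'(A) ΔA = -∫ β''(A) ‖∇A‖²`
for smooth `A` and `β` (Evans, App. C.2, Thm. 3, on `T^d`). [folklore] -/
theorem integral_deriv_comp_mul_laplacian (hβ : ContDiff ℝ ∞ β) (hA : FunctionSpaces.Torus.IsSmooth A) :
    ∫ x, deriv β (A x) * FunctionSpaces.Torus.laplacian A x =
      -∫ x, deriv (deriv β) (A x) * ‖FunctionSpaces.Torus.gradient A x‖ ^ 2 := by
  classical
  have hA1 : FunctionSpaces.Torus.IsContDiff 1 A := hA.isContDiff (by simp)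
  have hβ' : ContDiff ℝ ∞ (deriv β) := (contDiff_infty_iff_deriv.1 hβ).2
  have hβ'1 : ContDiff ℝ 1 (deriv β) := hβ'.of_le (by simp)
  have hcomp : FunctionSpaces.Torus.IsSmooth (deriv β ∘ A) := hA.comp_left hβ'
  have h := FunctionSpaces.Torus.integral_mul_laplacian_eq_neg_sum hcomp hA
  simp only [Function.comp_apply] at h
  rw [h]
  congr 1
  have hpd : ∀ i x, FunctionSpaces.Torus.partialDeriv i (deriv β ∘ A) x * FunctionSpaces.Torus.partialDeriv i A x =
      deriv (deriv β) (A x) * FunctionSpaces.Torus.partialDeriv i A x ^ 2 := by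
    intro i x
    rw [partialDeriv_comp_left hβ'1 hA1, sq]
    ring
  simp_rw [hpd]
  rw [← integral_finsetSum _ fun i _ => ?_]
  · refine integral_congr_ae (Eventually.of_forall fun x => ?_)
    dsimp only
    rw [← Finset.mul_sum, EuclideanSpace.norm_sq_eq]
    congr 1
    refine Finset.sum_congr rfl fun i _ => ?_
    rw [FunctionSpaces.Torus.gradient_apply hA1, Real.norm_eq_abs, sq_abs]
  · exact ((hβ'.of_le (by simp) |>.continuous_deriv le_rfl |>.comp hA.continuous).mul
      ((hA.partialDeriv i).continuous.pow 2)).integrable_unitAddTorus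

end SliceIntegrals

/-! ## The flux algebra for integrable drifts -/

section Flux

variable {δ : UnitAddTorus d → ℝ} {v : UnitAddTorus d → EuclideanSpace ℝ d} {k : UnitAddTorus d → ℝ}

/-- **Algebra of the flux** for integrable drifts: `G = r - ⟪v, ∇A⟫ + κ ΔA` pointwise, where
`A = δ ⋆ k`, `G(x) = ∫ δ(y) (-⟪v y, ∇k(x-y)⟫ + κ Δk(x-y)) dy` and
`r(x) = ∫ δ(y) ⟪v x - v y, ∇k(x-y)⟫ dy` (DiPerna–Lions 1989, §II.1); the tree's
`Torus.fluxIntegral_eq_comm_sub_add` for continuous `v`, here for `δ, ‖v‖δ ∈ L¹`. [folklore] -/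
theorem fluxIntegral_eq_comm_sub_add_of_integrable (hδ : Integrable δ volume)
    (hv : AEStronglyMeasurable v volume) (hvδ : Integrable (fun y => ‖v y‖ * δ y) volume)
    (hk : FunctionSpaces.Torus.IsSmooth k) (κ : ℝ) (x : UnitAddTorus d) :
    ∫ y, δ y * (-⟪v y, FunctionSpaces.Torus.gradient k (x - y)⟫_ℝ + κ * FunctionSpaces.Torus.laplacian k (x - y)) =
      (∫ y, δ y * ⟪v x - v y, FunctionSpaces.Torus.gradient k (x - y)⟫_ℝ) -
        ⟪v x, FunctionSpaces.Torus.gradient (δ ⋆ k) x⟫_ℝ + κ * FunctionSpaces.Torus.laplacian (δ ⋆ k) x := by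
  have hgc : Continuous fun y => FunctionSpaces.Torus.gradient k (x - y) :=
    hk.gradient.continuous.comp (continuous_const.sub continuous_id)
  have hlc : Continuous fun y => FunctionSpaces.Torus.laplacian k (x - y) :=
    hk.laplacian.continuous.comp (continuous_const.sub continuous_id)
  obtain ⟨Ck, hCk⟩ := FunctionSpaces.Torus.exists_forall_norm_le_of_continuous hk.gradient.continuous
  obtain ⟨Cl, hCl⟩ := FunctionSpaces.Torus.exists_forall_norm_le_of_continuous hk.laplacian.continuous
  -- the pieces are integrable
  have i1 : Integrable (fun y => δ y * ⟪v y, FunctionSpaces.Torus.gradient k (x - y)⟫_ℝ) volume := by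
    refine Integrable.mono' (hvδ.norm.const_mul Ck)
      (hδ.aestronglyMeasurable.mul (hv.inner hgc.aestronglyMeasurable)) (Eventually.of_forall fun y => ?_)
    simp only [Real.norm_eq_abs, abs_mul]
    calc |δ y| * |⟪v y, FunctionSpaces.Torus.gradient k (x - y)⟫_ℝ|
        ≤ |δ y| * (‖v y‖ * Ck) := mul_le_mul_of_nonneg_left
          ((abs_real_inner_le_norm _ _).trans (mul_le_mul_of_nonneg_left (hCk _) (norm_nonneg _))) (abs_nonneg _)
      _ = Ck * (|‖v y‖| * |δ y|) := by rw [abs_norm]; ring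
  have i2 : Integrable (fun y => δ y * ⟪v x, FunctionSpaces.Torus.gradient k (x - y)⟫_ℝ) volume := by
    refine hδ.mul_bdd (c := ‖v x‖ * Ck) (continuous_const.inner hgc).aestronglyMeasurable
      (Eventually.of_forall fun y => ?_)
    rw [Real.norm_eq_abs]
    exact (abs_real_inner_le_norm _ _).trans (mul_le_mul_of_nonneg_left (hCk _) (norm_nonneg _))
  have i3 : Integrable (fun y => δ y * FunctionSpaces.Torus.laplacian k (x - y)) volume :=
    hδ.mul_bdd (c := Cl) hlc.aestronglyMeasurable (Eventually.of_forall fun y => hCl _)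
  -- `∇A = δ ⋆ ∇k`, `ΔA = δ ⋆ Δk`
  have hgrad : ⟪v x, FunctionSpaces.Torus.gradient (δ ⋆ k) x⟫_ℝ = ∫ y, δ y * ⟪v x, FunctionSpaces.Torus.gradient k (x - y)⟫_ℝ := by
    rw [FunctionSpaces.Torus.gradient_convolution hδ hk, convolution_lsmul, ← integral_inner (FunctionSpaces.Torus.integrable_smul_comp_sub hδ
      hk.gradient.continuous x)]
    refine integral_congr_ae (Eventually.of_forall fun y => ?_)
    dsimp only
    rw [real_inner_smul_right]
  have hlap : FunctionSpaces.Torus.laplacian (δ ⋆ k) x = ∫ y, δ y * FunctionSpaces.Torus.laplacian k (x - y) := by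
    rw [FunctionSpaces.Torus.laplacian_convolution hδ hk, convolution_lsmul]
    simp
  rw [hgrad, hlap]
  have e1 : ∫ y, δ y * (-⟪v y, FunctionSpaces.Torus.gradient k (x - y)⟫_ℝ + κ * FunctionSpaces.Torus.laplacian k (x - y)) =
      κ * (∫ y, δ y * FunctionSpaces.Torus.laplacian k (x - y)) - ∫ y, δ y * ⟪v y, FunctionSpaces.Torus.gradient k (x - y)⟫_ℝ := by
    rw [← MeasureTheory.integral_const_mul, ← integral_sub (i3.const_mul κ) i1]
    refine integral_congr_ae (Eventually.of_forall fun y => ?_)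
    dsimp only
    ring
  have e2 : ∫ y, δ y * ⟪v x - v y, FunctionSpaces.Torus.gradient k (x - y)⟫_ℝ =
      (∫ y, δ y * ⟪v x, FunctionSpaces.Torus.gradient k (x - y)⟫_ℝ) - ∫ y, δ y * ⟪v y, FunctionSpaces.Torus.gradient k (x - y)⟫_ℝ := by
    rw [← integral_sub i2 i1]
    refine integral_congr_ae (Eventually.of_forall fun y => ?_)
    dsimp only
    rw [inner_sub_left, mul_sub]
  rw [e1, e2]
  ring

/-- **The renormalised slice identity** (DiPerna–Lions 1989, §II.3, the equation for `β(u_ε)`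
paired with `1`): for `δ ∈ L¹`, an integrable weakly divergence-free `v` with `‖v‖δ ∈ L¹`,
smooth `k` and `β`, `A = δ ⋆ k`, the flux `G` and the commutator `r` as above,
`∫ β'(A) G = ∫ β'(A) r - κ ∫ β''(A) ‖∇A‖²`. [cite: DiPernaLions1989, §II.3] -/
theorem integral_deriv_comp_mul_flux_eq {β : ℝ → ℝ} (hβ : ContDiff ℝ ∞ β) (hδ : Integrable δ volume)
    (hv : Integrable v volume) (hvδ : Integrable (fun y => ‖v y‖ * δ y) volume)
    (hdiv : FunctionSpaces.Torus.IsWeaklyDivFree v) (hk : FunctionSpaces.Torus.IsSmooth k) (κ : ℝ) :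
    ∫ x, deriv β ((δ ⋆ k) x) *
        ∫ y, δ y * (-⟪v y, FunctionSpaces.Torus.gradient k (x - y)⟫_ℝ + κ * FunctionSpaces.Torus.laplacian k (x - y)) =
      (∫ x, deriv β ((δ ⋆ k) x) * ∫ y, δ y * ⟪v x - v y, FunctionSpaces.Torus.gradient k (x - y)⟫_ℝ) -
        κ * ∫ x, deriv (deriv β) ((δ ⋆ k) x) * ‖FunctionSpaces.Torus.gradient (δ ⋆ k) x‖ ^ 2 := by
  set A : UnitAddTorus d → ℝ := δ ⋆ k with hA_def
  have hA : FunctionSpaces.Torus.IsSmooth A := FunctionSpaces.Torus.isSmooth_convolution hδ hk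
  have hβ'c : Continuous (deriv β) := hβ.continuous_deriv (by simp)
  -- `β'(A)` is bounded and continuous
  have hbc : Continuous fun x => deriv β (A x) := hβ'c.comp hA.continuous
  obtain ⟨Cb, hCb⟩ := FunctionSpaces.Torus.exists_forall_norm_le_of_continuous hbc
  -- the three pieces of `β'(A) G`
  have hGc := continuous_fluxIntegral hδ hv.aestronglyMeasurable hvδ hk κ
  have hsplit := fun x => fluxIntegral_eq_comm_sub_add_of_integrable hδ hv.aestronglyMeasurable hvδ hk κ x
  -- integrability of `β'(A) ⟪v, ∇A⟫` and `β'(A) ΔA`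
  obtain ⟨Cg, hCg⟩ := FunctionSpaces.Torus.exists_forall_norm_le_of_continuous hA.gradient.continuous
  have j2 : Integrable (fun x => deriv β (A x) * ⟪v x, FunctionSpaces.Torus.gradient A x⟫_ℝ) volume := by
    refine Integrable.mono' (hv.norm.const_mul (Cb * Cg))
      (hbc.aestronglyMeasurable.mul (hv.aestronglyMeasurable.inner hA.gradient.continuous.aestronglyMeasurable))
      (Eventually.of_forall fun x => ?_)
    rw [norm_mul]
    have hCb0 : 0 ≤ Cb := (norm_nonneg _).trans (hCb x)
    calc ‖deriv β (A x)‖ * ‖⟪v x, FunctionSpaces.Torus.gradient A x⟫_ℝ‖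
        ≤ Cb * (‖v x‖ * Cg) := mul_le_mul (hCb x) (by
          rw [Real.norm_eq_abs]
          exact (abs_real_inner_le_norm _ _).trans (mul_le_mul_of_nonneg_left (hCg _) (norm_nonneg _)))
          (norm_nonneg _) hCb0
      _ = Cb * Cg * ‖v x‖ := by ring
  have j3 : Integrable (fun x => deriv β (A x) * (κ * FunctionSpaces.Torus.laplacian A x)) volume :=
    (hbc.mul (continuous_const.mul hA.laplacian.continuous)).integrable_unitAddTorus
  have jG : Integrable (fun x => deriv β (A x) *
      ∫ y, δ y * (-⟪v y, FunctionSpaces.Torus.gradient k (x - y)⟫_ℝ + κ * FunctionSpaces.Torus.laplacian k (x - y))) volume :=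
    (hbc.mul hGc).integrable_unitAddTorus
  -- the commutator piece is integrable as a combination of the others
  have hr : (fun x => deriv β (A x) * ∫ y, δ y * ⟪v x - v y, FunctionSpaces.Torus.gradient k (x - y)⟫_ℝ) =
      fun x => deriv β (A x) *
        (∫ y, δ y * (-⟪v y, FunctionSpaces.Torus.gradient k (x - y)⟫_ℝ + κ * FunctionSpaces.Torus.laplacian k (x - y))) +
        deriv β (A x) * ⟪v x, FunctionSpaces.Torus.gradient A x⟫_ℝ -
        deriv β (A x) * (κ * FunctionSpaces.Torus.laplacian A x) := by
    funext x
    rw [hsplit x]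
    ring
  have j1 : Integrable (fun x => deriv β (A x) * ∫ y, δ y * ⟪v x - v y, FunctionSpaces.Torus.gradient k (x - y)⟫_ℝ) volume := by
    rw [hr]
    exact (jG.add j2).sub j3
  -- assemble
  have e : (fun x => deriv β (A x) *
      ∫ y, δ y * (-⟪v y, FunctionSpaces.Torus.gradient k (x - y)⟫_ℝ + κ * FunctionSpaces.Torus.laplacian k (x - y))) =
      fun x => deriv β (A x) * (∫ y, δ y * ⟪v x - v y, FunctionSpaces.Torus.gradient k (x - y)⟫_ℝ) -
        deriv β (A x) * ⟪v x, FunctionSpaces.Torus.gradient A x⟫_ℝ +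
        deriv β (A x) * (κ * FunctionSpaces.Torus.laplacian A x) := by
    funext x
    rw [hsplit x]
    ring
  have hadd := integral_add (j1.sub j2) j3
  simp only [Pi.sub_apply] at hadd
  rw [e, hadd, integral_sub j1 j2, integral_deriv_comp_mul_inner_gradient_eq_zero hβ hA hdiv, sub_zero]
  have e3 : ∫ x, deriv β (A x) * (κ * FunctionSpaces.Torus.laplacian A x) =
      κ * ∫ x, deriv β (A x) * FunctionSpaces.Torus.laplacian A x := by
    rw [← MeasureTheory.integral_const_mul]
    exact integral_congr_ae (Eventually.of_forall fun x => by ring)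
  rw [e3, integral_deriv_comp_mul_laplacian hβ hA]
  ring

end Flux

end Torus

end Literature.Analysis.FluidPDE
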